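import Summits.Ventures.Crystal3D.Theorems.StickyWulffConstantCoaxialWallLawWordStep
import Summits.Ventures.Crystal3D.Theorems.StickyWulffConstantGenericWallFloorSaturationStructure
import Summits.Ventures.Crystal3D.Theorems.StickyWulffConstantGenericWallFloorTwinFrame
import HarnessLib

/-!
# Exact end accounting for the word automaton, I: a class and its mirror class never END at the same ball (the Σ3 double top is excluded by the kissing gap)

HONEST FRAMING. Part of the venture `Summits/Ventures/Crystal3D` (cell `crystal3d-full`), helper for the crux
`CoaxialWallLaw` (stmt-Ventures-19481) of `route-Ventures-StickyWulffConstant`, REGISTERED line `WallLedgerF`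
(planner cf-p1 gen 16), open stub `stub_coaxialTwoSlabAdhesion` (general fillings).  Rung credit only; F-C1 not
moved.  This file belongs to the EXACT END ACCOUNTING of the in-plane-rooted v2 word automaton (memo
F-FRONTIER-g5 §4(b), evidence on the crux item): the residual-free laws `…InPlaneTwin` / `…TransGeneric` /
`…WordTransPlane` lose the factor `2·13·220` against the sharp constant `(√6/4)·sin θ` because every END of a line is
charged to SOME unsaturated ball within contact distance one, with the crude multiplicity `M = 220` classes per ball.
Sharp accounting charges a REACHABLE end `(b, κ)` (the target of a move from a saturated ball `b − d κ`) to `b`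
itself; the remaining loss is then the END MULTIPLICITY of `b` — the number of reachable classes ending at `b` —
against its deficiency `12 − deg b`.  Memo F-FRONTIER-g5 §4(b) lists the «Σ3 DOUBLE TOP» (a ball topping two saturated
balls of TWIN-RELATED frames, eleven contacts) as the one local configuration where two ends could meet one unit of
deficiency.  THIS FILE SHOWS IT CANNOT OCCUR IN THIS AUTOMATON: the direction of the mirror class `next κ m` crosses
`m` again (`⟪d (next κ m), m⟫ = +√(2/3)`, brick W1), so the two would-be predecessors `b − d κ` and
`b − d (next κ m)` of a common target ball `b` are at squared distance `4/3` or `1/3` — closer than the kissing gap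
`δ/2 = 5/4` of a saturated ball and not touching.  Hence, under `KissingGap δ` with `δ² > 16/3` (the tree's `δ = 5/2`
qualifies), a class and its mirror class are never both REACHED at one ball.  Only `1`-separation and `KissingGap` BY
NAME are used; everything is in the abstract class setting of `…WordMoves` / `…WordCore` (frames `F`, directions
`d κ = F κ u_κ`, class change `next` with `F (next κ m) = M_m ∘ F κ` and `⟪d (next κ m), m⟫ = √(2/3)`).

* `norm_sub_two_mul_inner_smul` — a `{111}` mirror is norm-preserving (`‖x − 2⟪x,m⟫ m‖ = ‖x‖`, `‖m‖ = 1`).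
* `card_contacts_eq_twelve_of_full`, `card_contacts_eq_twelve_of_twinDozen` — a ball with a FULL slot shell, resp.
  a ball that READS AS A TWIN DOZEN (own closed lower half-dozen and the three mirror balls present), has exactly
  twelve contacts: the ball of every MOVING state of the automaton is saturated, so `KissingGap` applies AT IT
  (`eq_or_dist_eq_one_or_le_dist_of_saturated`).
* `dist_sq_pred_pred_next` — `‖d κ − d (next κ m)‖² ∈ {4/3, 1/3}` for a crossing normal `m` of `κ`.
* **`not_mem_pred_next_of_saturated`** — if `b − d κ ∈ X` has twelve contacts then `b − d (next κ m) ∉ X`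
  (`KissingGap δ`, `δ² > 16/3`).  Read: the targets `(b, κ)` and `(b, next κ m)` are never both reachable, since a
  reachable state's predecessor ball is the (saturated) ball it was moved from (`word_move_target`).  (`δ > 0` is
  required: `KissingGap δ` is vacuous in the gap for `δ ≤ 2`.)
* `word_moving_saturated` — the ball of a moving state (full shell or twin reading) has twelve contacts.

WHAT THIS IS NOT: not the stub; the exact count itself (sources ≤ reachable ends + rim), the other multiplicity
cases (non-co-axial double tops: `DoubleTopFar`; twin-reading predecessors; triple tops) and the assembly are the next
bricks; F-C1 not moved.
-/

noncomputable section

namespace Summit.Ventures.Crystal3D.Theorems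

open Summit.Ventures.Crystal3D Finset
open Literature.MathematicalPhysics.StatisticalMechanics (fccStacking)
open scoped InnerProductSpace

variable {X : Finset (EuclideanSpace ℝ (Fin 3))}

/-! ### Mirrors preserve norms; reading balls are saturated -/

/-- A `{111}` mirror (indeed any reflection `x ↦ x − 2⟪x, m⟫ m` in a unit vector `m`) preserves the norm. -/
theorem norm_sub_two_mul_inner_smul {m : EuclideanSpace ℝ (Fin 3)} (hm : ‖m‖ = 1) (x : EuclideanSpace ℝ (Fin 3)) :
    ‖x - (2 * ⟪x, m⟫_ℝ) • m‖ = ‖x‖ := by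
  have h1 : ‖x - (2 * ⟪x, m⟫_ℝ) • m‖ ^ 2 = ‖x‖ ^ 2 := by
    rw [norm_sub_sq_real, real_inner_smul_right, norm_smul, Real.norm_eq_abs, hm, mul_one, sq_abs]
    ring
  exact (pow_left_inj₀ (norm_nonneg _) (norm_nonneg _) two_ne_zero).1 h1

open scoped Classical in
/-- **A ball with a full slot shell has exactly twelve contacts** (`1`-separation: at most twelve; the twelve
slot balls are distinct contacts). -/
theorem card_contacts_eq_twelve_of_full (hX : ∀ p ∈ X, ∀ q ∈ X, p ≠ q → 1 ≤ dist p q)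
    (G : EuclideanSpace ℝ (Fin 3) ≃ₗᵢ[ℝ] EuclideanSpace ℝ (Fin 3)) {y : EuclideanSpace ℝ (Fin 3)}
    (hfull : ∀ w ∈ fccSlots, y + G w ∈ X) :
    (X.filter fun q => dist y q = 1).card = 12 := by
  refine le_antisymm (card_filter_dist_eq_one_le_twelve X hX y) ?_
  rw [← card_fccSlots]
  refine Finset.card_le_card_of_injOn (fun w => y + G w) (fun w hw => ?_) ?_
  · rw [Finset.mem_coe, Finset.mem_filter]
    refine ⟨hfull w hw, ?_⟩
    rw [dist_self_add_right, LinearIsometryEquiv.norm_map, norm_eq_one_of_mem_fccSlots hw]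
  · intro w₁ _ w₂ _ h
    exact G.injective (add_left_cancel h)

open scoped Classical in
/-- **A ball that reads as a twin dozen has exactly twelve contacts**: the nine own slots `⟪G w, m⟫ ≤ 0` and the
three mirror balls `y + (G w − 2⟪G w, m⟫ m)`, `⟪G w, m⟫ < 0`, are twelve distinct contacts. -/
theorem card_contacts_eq_twelve_of_twinDozen (hX : ∀ p ∈ X, ∀ q ∈ X, p ≠ q → 1 ≤ dist p q)
    (G : EuclideanSpace ℝ (Fin 3) ≃ₗᵢ[ℝ] EuclideanSpace ℝ (Fin 3)) {m : EuclideanSpace ℝ (Fin 3)} (hm : ‖m‖ = 1)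
    {y : EuclideanSpace ℝ (Fin 3)}
    (hown : ∀ w ∈ fccSlots, ⟪G w, m⟫_ℝ ≤ 0 → y + G w ∈ X)
    (hmir : ∀ w ∈ fccSlots, ⟪G w, m⟫_ℝ < 0 → y + (G w - (2 * ⟪G w, m⟫_ℝ) • m) ∈ X) :
    (X.filter fun q => dist y q = 1).card = 12 := by
  refine le_antisymm (card_filter_dist_eq_one_le_twelve X hX y) ?_
  rw [← card_fccSlots]
  -- the reading map: own slots to themselves, far slots to the mirror image of the opposite slot
  set φ : EuclideanSpace ℝ (Fin 3) → EuclideanSpace ℝ (Fin 3) := fun w =>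
    if ⟪G w, m⟫_ℝ ≤ 0 then y + G w else y + (G (-w) - (2 * ⟪G (-w), m⟫_ℝ) • m) with hφ
  have mm : ⟪m, m⟫_ℝ = 1 := by rw [real_inner_self_eq_norm_sq, hm, one_pow]
  -- the menu value of a mirror image
  have hmirval : ∀ w : EuclideanSpace ℝ (Fin 3), ⟪G (-w) - (2 * ⟪G (-w), m⟫_ℝ) • m, m⟫_ℝ = ⟪G w, m⟫_ℝ := by
    intro w
    rw [inner_sub_left, real_inner_smul_left, mm, map_neg, inner_neg_left]; ring
  refine Finset.card_le_card_of_injOn φ (fun w hw => ?_) ?_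
  · rw [Finset.mem_coe, Finset.mem_filter]
    by_cases hle : ⟪G w, m⟫_ℝ ≤ 0
    · simp only [hφ, hle, if_true]
      exact ⟨hown w hw hle, by rw [dist_self_add_right, LinearIsometryEquiv.norm_map, norm_eq_one_of_mem_fccSlots hw]⟩
    · simp only [hφ, hle, if_false]
      have hneg : ⟪G (-w), m⟫_ℝ < 0 := by rw [map_neg, inner_neg_left]; linarith
      refine ⟨hmir (-w) (neg_mem_fccSlots hw) hneg, ?_⟩
      rw [dist_self_add_right, norm_sub_two_mul_inner_smul hm, LinearIsometryEquiv.norm_map,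
        norm_eq_one_of_mem_fccSlots (neg_mem_fccSlots hw)]
  · intro w₁ hw₁ w₂ hw₂ h
    have hw₁' := Finset.mem_coe.1 hw₁
    have hw₂' := Finset.mem_coe.1 hw₂
    by_cases h₁ : ⟪G w₁, m⟫_ℝ ≤ 0 <;> by_cases h₂ : ⟪G w₂, m⟫_ℝ ≤ 0
    · simp only [hφ, h₁, h₂, if_true] at h
      exact G.injective (add_left_cancel h)
    · exfalso
      simp only [hφ, h₁, h₂, if_true, if_false] at h
      have := congrArg (fun x => ⟪x - y, m⟫_ℝ) h
      simp only [add_sub_cancel_left, hmirval] at this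
      linarith
    · exfalso
      simp only [hφ, h₁, h₂, if_true, if_false] at h
      have := congrArg (fun x => ⟪x - y, m⟫_ℝ) h
      simp only [add_sub_cancel_left, hmirval] at this
      linarith
    · simp only [hφ, h₁, h₂, if_false] at h
      have h' := add_left_cancel h
      -- mirror images agree ⇒ the slots agree (apply the mirror again)
      have e : ∀ x : EuclideanSpace ℝ (Fin 3), (x - (2 * ⟪x, m⟫_ℝ) • m) - (2 * ⟪x - (2 * ⟪x, m⟫_ℝ) • m, m⟫_ℝ) • m = x := by
        intro x
        rw [inner_sub_left, real_inner_smul_left, mm]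
        module
      have := congrArg (fun x => x - (2 * ⟪x, m⟫_ℝ) • m) h'
      simp only [e] at this
      have := G.injective this
      exact neg_injective this

section Word

variable {K : Type*} {F : K → (EuclideanSpace ℝ (Fin 3) ≃ₗᵢ[ℝ] EuclideanSpace ℝ (Fin 3))}
  {d : K → EuclideanSpace ℝ (Fin 3)} {next : K → EuclideanSpace ℝ (Fin 3) → K}
  {W : Finset (EuclideanSpace ℝ (Fin 3) × K)}
  {f : EuclideanSpace ℝ (Fin 3) × K → EuclideanSpace ℝ (Fin 3) × K}

/-- **The two predecessors of a common target of a class and its mirror class are `√(4/3)` or `√(1/3)` apart.**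
For a crossing normal `m` of `κ` (`⟪d κ, m⟫ = √(2/3)`): `‖d κ − d (next κ m)‖² = 4/3` or `= 1/3`.  Indeed
`d (next κ m) = M_m (F κ u')` with `⟪F κ u', m⟫ = −√(2/3)` and `d κ = F κ u` with `⟪F κ u, m⟫ = +√(2/3)`, so
`‖d κ − d (next κ m)‖² = −2/3 − 2⟪u, u'⟫`, and two slots meet at `⟪u, u'⟫ ∈ {±1, ±½, 0}`. -/
theorem dist_sq_pred_pred_next
    (hd : ∀ κ, ∃ u ∈ fccSlots, d κ = F κ u)
    (hmirror : ∀ κ (m : EuclideanSpace ℝ (Fin 3)), ‖m‖ = 1 →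
      (∀ w ∈ fccSlots, ⟪F κ w, m⟫_ℝ = 0 ∨ ⟪F κ w, m⟫_ℝ = Real.sqrt (2 / 3) ∨ ⟪F κ w, m⟫_ℝ = -Real.sqrt (2 / 3)) →
      ⟪d κ, m⟫_ℝ = Real.sqrt (2 / 3) → ∀ x, F (next κ m) x = F κ x - (2 * ⟪F κ x, m⟫_ℝ) • m)
    (hdnext : ∀ κ (m : EuclideanSpace ℝ (Fin 3)), ‖m‖ = 1 →
      (∀ w ∈ fccSlots, ⟪F κ w, m⟫_ℝ = 0 ∨ ⟪F κ w, m⟫_ℝ = Real.sqrt (2 / 3) ∨ ⟪F κ w, m⟫_ℝ = -Real.sqrt (2 / 3)) →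
      ⟪d κ, m⟫_ℝ = Real.sqrt (2 / 3) → ⟪d (next κ m), m⟫_ℝ = Real.sqrt (2 / 3))
    {κ : K} {m : EuclideanSpace ℝ (Fin 3)} (hm : ‖m‖ = 1)
    (hmenu : ∀ w ∈ fccSlots, ⟪F κ w, m⟫_ℝ = 0 ∨ ⟪F κ w, m⟫_ℝ = Real.sqrt (2 / 3) ∨ ⟪F κ w, m⟫_ℝ = -Real.sqrt (2 / 3))
    (hdm : ⟪d κ, m⟫_ℝ = Real.sqrt (2 / 3)) (b : EuclideanSpace ℝ (Fin 3)) :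
    dist (b - d κ) (b - d (next κ m)) ^ 2 = 4 / 3 ∨ dist (b - d κ) (b - d (next κ m)) ^ 2 = 1 / 3 := by
  have h23 : Real.sqrt (2 / 3) ^ 2 = 2 / 3 := Real.sq_sqrt (by norm_num)
  have mm : ⟪m, m⟫_ℝ = 1 := by rw [real_inner_self_eq_norm_sq, hm, one_pow]
  obtain ⟨u, hu, hdu⟩ := hd κ
  obtain ⟨u', hu', hdu'⟩ := hd (next κ m)
  have hF' : ∀ x, F (next κ m) x = F κ x - (2 * ⟪F κ x, m⟫_ℝ) • m := hmirror κ m hm hmenu hdm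
  have hd'm : ⟪d (next κ m), m⟫_ℝ = Real.sqrt (2 / 3) := hdnext κ m hm hmenu hdm
  -- menu values of `u` and `u'`
  have hum : ⟪F κ u, m⟫_ℝ = Real.sqrt (2 / 3) := by rw [← hdu]; exact hdm
  have hu'm : ⟪F κ u', m⟫_ℝ = -Real.sqrt (2 / 3) := by
    have h1 : ⟪F (next κ m) u', m⟫_ℝ = -⟪F κ u', m⟫_ℝ := by
      rw [hF' u', inner_sub_left, real_inner_smul_left, mm]; ring
    rw [← hdu', hd'm] at h1; linarith
  -- the squared distance
  have hdist : dist (b - d κ) (b - d (next κ m)) ^ 2 = -(2 / 3) - 2 * ⟪u, u'⟫_ℝ := by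
    rw [dist_eq_norm, sub_sub_sub_cancel_left, norm_sub_sq_real, hdu, hdu', hF' u',
      LinearIsometryEquiv.norm_map, norm_eq_one_of_mem_fccSlots hu,
      norm_sub_two_mul_inner_smul hm, LinearIsometryEquiv.norm_map, norm_eq_one_of_mem_fccSlots hu',
      inner_sub_left, real_inner_smul_left, real_inner_comm (F κ u) m, hum, hu'm,
      LinearIsometryEquiv.inner_map_map, real_inner_comm u' u]
    nlinarith [h23]
  have hnn : (0 : ℝ) ≤ dist (b - d κ) (b - d (next κ m)) ^ 2 := sq_nonneg _
  rcases inner_slots_mem hu hu' with h | h | h | h | h <;> rw [h] at hdist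
  · linarith
  · linarith
  · linarith
  · right; rw [hdist]; norm_num
  · left; rw [hdist]; norm_num

open scoped Classical in
/-- **A class and its mirror class are never both reached at one ball** (the «Σ3 double top» of memo
F-FRONTIER-g5 §4(b) does not occur in this automaton).  If the predecessor ball `b − d κ ∈ X` of the target
`(b, κ)` is saturated, then `b − d (next κ m) ∉ X` for every crossing normal `m` of `κ`: by
`dist_sq_pred_pred_next` the two balls would be `√(4/3)` or `√(1/3)` apart — excluded by `1`-separation and by
`KissingGap δ` at the saturated ball once `δ > 0`, `δ² > 16/3` (`δ = 5/2`: `25/4 > 16/3`).  Inputs: `KissingGap δ`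
BY NAME. -/
theorem not_mem_pred_next_of_saturated {δ : ℝ} (hg : KissingGap δ) (hδ0 : 0 < δ) (hδ : 16 / 3 < δ ^ 2)
    (hX : ∀ p ∈ X, ∀ q ∈ X, p ≠ q → 1 ≤ dist p q)
    (hd : ∀ κ, ∃ u ∈ fccSlots, d κ = F κ u)
    (hmirror : ∀ κ (m : EuclideanSpace ℝ (Fin 3)), ‖m‖ = 1 →
      (∀ w ∈ fccSlots, ⟪F κ w, m⟫_ℝ = 0 ∨ ⟪F κ w, m⟫_ℝ = Real.sqrt (2 / 3) ∨ ⟪F κ w, m⟫_ℝ = -Real.sqrt (2 / 3)) →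
      ⟪d κ, m⟫_ℝ = Real.sqrt (2 / 3) → ∀ x, F (next κ m) x = F κ x - (2 * ⟪F κ x, m⟫_ℝ) • m)
    (hdnext : ∀ κ (m : EuclideanSpace ℝ (Fin 3)), ‖m‖ = 1 →
      (∀ w ∈ fccSlots, ⟪F κ w, m⟫_ℝ = 0 ∨ ⟪F κ w, m⟫_ℝ = Real.sqrt (2 / 3) ∨ ⟪F κ w, m⟫_ℝ = -Real.sqrt (2 / 3)) →
      ⟪d κ, m⟫_ℝ = Real.sqrt (2 / 3) → ⟪d (next κ m), m⟫_ℝ = Real.sqrt (2 / 3))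
    {κ : K} {m : EuclideanSpace ℝ (Fin 3)} (hm : ‖m‖ = 1)
    (hmenu : ∀ w ∈ fccSlots, ⟪F κ w, m⟫_ℝ = 0 ∨ ⟪F κ w, m⟫_ℝ = Real.sqrt (2 / 3) ∨ ⟪F κ w, m⟫_ℝ = -Real.sqrt (2 / 3))
    (hdm : ⟪d κ, m⟫_ℝ = Real.sqrt (2 / 3)) {b : EuclideanSpace ℝ (Fin 3)}
    (hpred : b - d κ ∈ X) (hsat : (X.filter fun q => dist (b - d κ) q = 1).card = 12) :
    b - d (next κ m) ∉ X := by
  intro hmem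
  have hsq := dist_sq_pred_pred_next hd hmirror hdnext hm hmenu hdm b
  have hne : b - d κ ≠ b - d (next κ m) := by
    intro h
    have h0 : dist (b - d κ) (b - d (next κ m)) = 0 := by rw [h, dist_self]
    rw [h0] at hsq; norm_num at hsq
  have h1 : (1 : ℝ) ≤ dist (b - d κ) (b - d (next κ m)) := hX _ hpred _ hmem hne
  have hsq' : dist (b - d κ) (b - d (next κ m)) ^ 2 = 4 / 3 := by
    rcases hsq with h | h
    · exact h
    · nlinarith
  rcases eq_or_dist_eq_one_or_le_dist_of_saturated hg hX hpred hsat hmem with h | h | h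
  · exact hne h.symm
  · rw [h] at hsq'; norm_num at hsq'
  · have : (δ / 2) ^ 2 ≤ dist (b - d κ) (b - d (next κ m)) ^ 2 := pow_le_pow_left₀ (by linarith) h 2
    rw [hsq'] at this
    nlinarith

open scoped Classical in
/-- **The ball of a MOVING state is saturated.**  A state whose ball has a full `F κ`-shell or reads as a twin dozen
of `(F κ, m)` (the two move patterns of `word_sources_le`) has exactly twelve contacts; so `KissingGap` applies at
the predecessor `b − d κ'` of every REACHED state `(b, κ')` (`word_move_target`: the predecessor of the target is the
ball moved from). -/
theorem word_moving_saturated (hX : ∀ p ∈ X, ∀ q ∈ X, p ≠ q → 1 ≤ dist p q)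
    {v : EuclideanSpace ℝ (Fin 3) × K}
    (hmov : (∀ w ∈ fccSlots, v.1 + F v.2 w ∈ X) ∨
      ∃ m : EuclideanSpace ℝ (Fin 3), ‖m‖ = 1 ∧
        (∀ w ∈ fccSlots, ⟪F v.2 w, m⟫_ℝ = 0 ∨ ⟪F v.2 w, m⟫_ℝ = Real.sqrt (2 / 3) ∨ ⟪F v.2 w, m⟫_ℝ = -Real.sqrt (2 / 3)) ∧
        (∀ w ∈ fccSlots, ⟪F v.2 w, m⟫_ℝ ≤ 0 → v.1 + F v.2 w ∈ X) ∧
        (∀ w ∈ fccSlots, ⟪F v.2 w, m⟫_ℝ < 0 → v.1 + (F v.2 w - (2 * ⟪F v.2 w, m⟫_ℝ) • m) ∈ X) ∧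
        (∀ w ∈ fccSlots, 0 < ⟪F v.2 w, m⟫_ℝ → v.1 + F v.2 w ∉ X) ∧
        (⟪d v.2, m⟫_ℝ = Real.sqrt (2 / 3) ∨ ⟪d v.2, m⟫_ℝ = 0)) :
    (X.filter fun q => dist v.1 q = 1).card = 12 := by
  rcases hmov with hfull | ⟨m, hm, -, hown, hmir, -, -⟩
  · exact card_contacts_eq_twelve_of_full hX (F v.2) hfull
  · exact card_contacts_eq_twelve_of_twinDozen hX (F v.2) hm hown hmir

end Word

end Summit.Ventures.Crystal3D.Theorems

end
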